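import Literature.MathematicalPhysics.QuantumLattice.KomaTasakiSSBOrderParameter
import HarnessLib

/-!
# Koma–Tasaki 1994 / 1993 with BOUNDED-OVERLAP order densities: the `U(1)` symmetry-breaking
# order parameter `√2 μ o` of the low-lying states `Ξ^{(k)}` (Thm 2.5 (2.30)) — PROVED

T. Koma, H. Tasaki, *Symmetry breaking and finite-size effects in quantum many-body systems*,
J. Stat. Phys. **76** (1994) 745–803 (`KomaTasaki1994`), §2.3 hypothesis i) asks the order-operator
densities to commute at DISTINCT sites, `[o^{(α)}_x, o^{(β)}_y] = 0` for `x ≠ y` (tree: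
`U1System.commute_o`, `KomaTasakiSSB.lean`).  For lattice ELECTRONS with a BOND (e.g. `d_{x²-y²}`)
pair field the natural densities `o^{(1)}_x = Φ_x + Φ_x†`, `o^{(2)}_x = i(Φ_x - Φ_x†)`
(`Φ_x` = the site-centred four-bond singlet pair field) do NOT satisfy i) literally: `Φ_x` and `Φ_y†`
share fermion modes, hence fail to commute, whenever `|x - y| ≤ 2` (KT94 §3.4: other pairings can be
treated "with some extra care"; KT93, CMP 158 (1993) §7: the `U(1)` theorem "allows one to apply the
theorem to … the electron pair condensation problems in lattice electron systems").  The "extra care" is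
the present file: hypothesis i) is weakened to

  i′) BOUNDED OVERLAP: `[o^{(α)}_x, o^{(β)}_y] = 0` unless `y ∈ T_x`, with `|T_x| ≤ r′`

(`U1OverlapSystem`; every `U1System` is one with `T_x = {x}`, `r′ = 1`, `U1System.toOverlap`), and
KT94 Theorem 2.5 (2.30) — the order parameter `≥ √2 μ o` of the symmetry-breaking low-lying states
`Ξ^{(k)}` (KT93 Theorem 7.3, (7.25)–(7.26)) — is re-proved in that generality with the single change
`o ↦ o r′` in the finite-size error term:

* `U1OverlapSystem.norm_orderComm_le` : `‖[O^{(1)}, O^{(2)}]‖ ≤ 2 o² r′ N` (only the pairs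
  `y ∈ T_x` survive; this is the ONE place where i) enters KT's argument);
* `U1OverlapSystem.norm_sq_orderPlus_pow_ge` / `…Minus…` : the moment bounds
  `‖(O^±)^{k+1} Φ‖² ≥ (2μ²o²N²)^{k+1} - (k+1)² (o r′) (2oN)^{2k+1}` (KT93 Lemma 7.4–7.5 / (7.26));
* `U1OverlapSystem.theorem_2_5_orderOne_fin` : for every `k ≥ 1` and every `N`,
  `0 ≤ Re (Ξ^{(k)}, O^{(1)} Ξ^{(k)})` and
  `(2(μoN)²)^k - k² (o r′) (2oN)^{2k-1} ≤ ((2k+1)/(2k) · Re (Ξ^{(k)}, O^{(1)} Ξ^{(k)}))^{2k}`;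
* `theorem_2_5_orderOne_overlap` / `…_holds` : the `ε`–`k₀`–`N₀` form, uniform over all bounded-overlap
  systems with given `o`, `μ` and `r′ ≤ R`: `N⁻¹ Re (Ξ^{(k)}, O^{(1)} Ξ^{(k)}) ≥ √2 μ o - ε`.

## How the landed proof is reused (no re-proof of the charge bookkeeping / AM–GM assembly)

The trial states `Ψ^{(M)} = (O^±)^{|M|}Φ/‖…‖`, `Ξ^{(k)}` (KT94 (2.19), (2.27)) and the whole of
KT93 (7.25) depend on the system only through the TOTAL operators `O^{(1)}, O^{(2)}, C, H`.  Summing all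
densities into a single site gives the ONE-SITE COLLAPSE `sys.collapse : U1System Unit E`
(`o′ = Σ_x o_x`, `h′ = Σ_x h_x`, `o′-bound o N`), a genuine `U1System` (i) is vacuous on one site) with
literally the same `O^{(α)}`, `O^±`, `C`, `H`, `Ψ^{(M)}`, `Ξ^{(k)}`; to it the tree's ABSTRACT assembly
`U1System.theorem_2_5_orderOne_fin_of_le` (KT93 (7.25)–(7.26) from an arbitrary moment lower bound
`L ≤ ‖(O^±)^k Φ‖²`) applies verbatim.  The collapse forgets locality — its own commutator bound
`2 o′² · 1 = 2 o² N²` would make the error term of the order of the main term — so the moment bound `L`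
is proved HERE from i′) (`δ = o r′` in the generic reordering lemma `norm_pow_mul_pow_sub_pow_le`,
KT93 Lemma 7.5) and fed to the assembly.  Hypotheses actually used: i′), iii) `‖o_x‖ ≤ o`, the charge
relations (2.14) and iv) (2.17); ii) and the Hamiltonian do not enter (2.30) (as in the tree's file).

## What this is for (cell hubbard-cq, START-HERE §2 O3 note / §4 row p4)

With i′) the KT machinery applies to the real `d`-wave order operator of the Hubbard model
(`T_x` = sites within graph distance `2`, `r′ ≤ 13` on `ℤ²`); the companion file (KT93 Theorem 7.3,
finite volume: energy of `Ξ^{(k)}` + the Kaplan–Horsch–von der Linden variational step under the field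
`-B O^{(1)}`) turns this into the sourced one-point bound `m_Λ(B) ≥ √2 μ o - ε`, i.e. the CEILING
direction "`m* ≤ c ⇒ σ² ≤ c²/2`" for pair long-range order.  Direction of the theorem: LRO ⇒ order
parameter of explicit symmetry-breaking states; the converse is not a theorem
(`Literature/Barriers/HubbardSuperconductivity/SourcedOrderWithoutGroundStateLRO.lean`).

## References

* T. Koma, H. Tasaki, J. Stat. Phys. 76 (1994) 745–803, §2.3 i)–iv), (2.14)–(2.17), Theorem 2.5
  (2.27)–(2.30); §3.4 (lattice electrons, "with some extra care").
* T. Koma, H. Tasaki, Commun. Math. Phys. 158 (1993) 191–214, §7: Theorem 7.3, Lemmas 7.4–7.5,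
  (7.18)–(7.26).

## Mathlib / tree search

`lean search 'U1System|xiState|orderComm|bounded overlap'`: only `KomaTasakiSSB*.lean`
(hypothesis i) hard-wired), `SourcedOrderWithoutGroundStateLROKomaTasakiClass.lean` (a `U1System`
instance); no overlap variant.  Reused: `U1System.theorem_2_5_orderOne_fin_of_le`,
`norm_pow_mul_pow_sub_pow_le`, `pow_re_inner_le_re_inner_pow`, `U1System.re_inner_orderSq_ge`,
`U1System.inner_orderPlus_pow_left` (KomaTasakiSSBOrderParameter), `norm_comm_le`, `norm_pow_le_of_le`
(KomaTasakiSSBProofs); Mathlib `Fintype.sum_unique`, `Finset.sum_subset`.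
-/

noncomputable section

open Complex Finset Filter
open scoped InnerProductSpace ComplexConjugate Topology

namespace Literature.MathematicalPhysics.QuantumLattice.KomaTasaki

universe u v

variable {Λ : Type u} [Fintype Λ] {E : Type v} [NormedAddCommGroup E] [InnerProductSpace ℂ E]

/-! ### The bounded-overlap `U(1)` system (KT94 §2.3 with i) replaced by i′)) -/

/-- **A Koma–Tasaki `U(1)` system with bounded-overlap order densities.**  Identical to
`U1System` (KT94 §2.3: local Hamiltonians `h_x`, order densities `o^{(α)}_x`, `U(1)` generator `C`
with `[H, C] = 0` (2.12) and `[O^{(1)}, C] = -iO^{(2)}`, `[O^{(2)}, C] = iO^{(1)}` (2.14), ii)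
`[h_x, o_y] = 0` unless `y ∈ S_x`, `|S_x| ≤ r`, iii) `‖h_x‖ ≤ h`, `‖o_x‖ ≤ o`, `o > 0`) except that
hypothesis i) `[o^{(α)}_x, o^{(β)}_y] = 0 (x ≠ y)` is weakened to the BOUNDED-OVERLAP form
i′) `[o^{(α)}_x, o^{(β)}_y] = 0` unless `y ∈ T_x`, `|T_x| ≤ r′` (for bond pair fields of lattice
electrons, KT94 §3.4 "with some extra care"). [cite: KomaTasaki1994, §2.3 (2.12)–(2.17), §3.4] -/
structure U1OverlapSystem (Λ : Type u) [Fintype Λ] (E : Type v) [NormedAddCommGroup E]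
    [InnerProductSpace ℂ E] where
  /-- local Hamiltonians `h_x` -/
  h : Λ → E →L[ℂ] E
  /-- order-operator densities `o^{(α)}_x`, `α ∈ {0, 1}` for KT's `α ∈ {1, 2}` -/
  o : Fin 2 → Λ → E →L[ℂ] E
  /-- the `U(1)` generator `C_Λ` -/
  C : E →L[ℂ] E
  /-- support sets `S_x` of hypothesis ii) -/
  supp : Λ → Finset Λ
  /-- the range bound `r` of ii) -/
  r : ℕ
  /-- overlap sets `T_x` of hypothesis i′): `o_x` and `o_y` commute unless `y ∈ T_x` -/
  osupp : Λ → Finset Λ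
  /-- the overlap bound `r′` of i′) -/
  r' : ℕ
  /-- the norm bound `h` on the `h_x` -/
  hbar : ℝ
  /-- the norm bound `o` on the `o_x` -/
  obar : ℝ
  isSymmetric_h : ∀ x, (h x : E →ₗ[ℂ] E).IsSymmetric
  isSymmetric_o : ∀ α x, (o α x : E →ₗ[ℂ] E).IsSymmetric
  isSymmetric_C : (C : E →ₗ[ℂ] E).IsSymmetric
  /-- (2.12) `[H_Λ, C_Λ] = 0` -/
  commute_hamiltonian_C : Commute (∑ x, h x) C
  /-- (2.14) `[O^{(1)}, C] = -i O^{(2)}` -/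
  order_zero_C : (∑ x, o 0 x) * C - C * (∑ x, o 0 x) = -(I • ∑ x, o 1 x)
  /-- (2.14) `[O^{(2)}, C] = i O^{(1)}` -/
  order_one_C : (∑ x, o 1 x) * C - C * (∑ x, o 1 x) = I • ∑ x, o 0 x
  /-- i′) bounded overlap -/
  commute_o : ∀ x y, y ∉ osupp x → ∀ α β, Commute (o α x) (o β y)
  /-- i′) -/
  card_osupp_le : ∀ x, (osupp x).card ≤ r'
  /-- ii) -/
  commute_h_o : ∀ x y, y ∉ supp x → ∀ α, Commute (h x) (o α y)
  /-- ii) -/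
  card_supp_le : ∀ x, (supp x).card ≤ r
  /-- ii) -/
  two_le_r : 2 ≤ r
  /-- iii) -/
  norm_h_le : ∀ x, ‖h x‖ ≤ hbar
  /-- iii) -/
  norm_o_le : ∀ α x, ‖o α x‖ ≤ obar
  /-- `o > 0` (tacit in KT, as in `U1System`). -/
  obar_pos : 0 < obar

/-- Every `U1System` (hypothesis i)) is a bounded-overlap system with `T_x = {x}`, `r′ = 1`.
[cite: KomaTasaki1994, §2.3 i)] -/
def U1System.toOverlap [DecidableEq Λ] (sys : U1System Λ E) : U1OverlapSystem Λ E where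
  h := sys.h
  o := sys.o
  C := sys.C
  supp := sys.supp
  r := sys.r
  osupp := fun x => {x}
  r' := 1
  hbar := sys.hbar
  obar := sys.obar
  isSymmetric_h := sys.isSymmetric_h
  isSymmetric_o := sys.isSymmetric_o
  isSymmetric_C := sys.isSymmetric_C
  commute_hamiltonian_C := sys.commute_hamiltonian_C
  order_zero_C := sys.order_zero_C
  order_one_C := sys.order_one_C
  commute_o := fun x y hy α β => sys.commute_o x y (fun hxy => hy (by simp [hxy])) α β
  card_osupp_le := fun x => by simp
  commute_h_o := sys.commute_h_o
  card_supp_le := sys.card_supp_le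
  two_le_r := sys.two_le_r
  norm_h_le := sys.norm_h_le
  norm_o_le := sys.norm_o_le
  obar_pos := sys.obar_pos

namespace U1OverlapSystem

variable (sys : U1OverlapSystem Λ E)

/-- The Hamiltonian `H_Λ = Σ_x h_x` (KT (2.3)). [cite: KomaTasaki1994, (2.3)] -/
def hamiltonian : E →L[ℂ] E := ∑ x, sys.h x

/-- The order operators `O^{(α)}_Λ = Σ_x o^{(α)}_x` (KT (2.13)). [cite: KomaTasaki1994, (2.13)] -/
def order (α : Fin 2) : E →L[ℂ] E := ∑ x, sys.o α x

/-! ### The one-site collapse: a genuine `U1System` with the same total operators -/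

/-- **The one-site collapse** of a bounded-overlap system: the `U1System` on the one-point lattice
`Unit` with `o′ = O^{(α)} = Σ_x o^{(α)}_x`, `h′ = H = Σ_x h_x`, the same `C`, `S = T = {⋆}`, `r = 2`,
and norm bounds `h′ ≤ N h`, `o′ ≤ o N`.  Hypothesis i) holds vacuously on one site; the total
operators, `O^±`, the trial states `Ψ^{(M)}`, `Ξ^{(k)}` and the charge relations are those of `sys`.
(Device of this file; it forgets locality, which is re-injected through `norm_orderComm_le`.)
[cite: KomaTasaki1994, §2.3] -/
def collapse [Nonempty Λ] : U1System Unit E where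
  h := fun _ => sys.hamiltonian
  o := fun α _ => sys.order α
  C := sys.C
  supp := fun _ => Finset.univ
  r := 2
  hbar := Fintype.card Λ * sys.hbar
  obar := sys.obar * Fintype.card Λ
  isSymmetric_h := fun _ => by
    intro φ ψ
    simp only [hamiltonian, ContinuousLinearMap.toLinearMap_sum, LinearMap.coe_sum,
      ContinuousLinearMap.coe_coe, Finset.sum_apply, sum_inner, inner_sum]
    exact Finset.sum_congr rfl fun x _ => sys.isSymmetric_h x φ ψ
  isSymmetric_o := fun α _ => by
    intro φ ψ
    simp only [order, ContinuousLinearMap.toLinearMap_sum, LinearMap.coe_sum,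
      ContinuousLinearMap.coe_coe, Finset.sum_apply, sum_inner, inner_sum]
    exact Finset.sum_congr rfl fun x _ => sys.isSymmetric_o α x φ ψ
  isSymmetric_C := sys.isSymmetric_C
  commute_hamiltonian_C := by
    rw [Fintype.sum_unique]
    exact sys.commute_hamiltonian_C
  order_zero_C := by
    simp only [Fintype.sum_unique, order]
    exact sys.order_zero_C
  order_one_C := by
    simp only [Fintype.sum_unique, order]
    exact sys.order_one_C
  commute_o := fun x y hxy => (hxy (Subsingleton.elim x y)).elim
  commute_h_o := fun _ y hy => (hy (Finset.mem_univ y)).elim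
  card_supp_le := fun _ => by simp
  two_le_r := le_rfl
  norm_h_le := fun _ => by
    calc ‖sys.hamiltonian‖ = ‖∑ x, sys.h x‖ := rfl
      _ ≤ ∑ x, ‖sys.h x‖ := norm_sum_le _ _
      _ ≤ ∑ _x : Λ, sys.hbar := Finset.sum_le_sum fun x _ => sys.norm_h_le x
      _ = Fintype.card Λ * sys.hbar := by rw [Finset.sum_const, Finset.card_univ, nsmul_eq_mul]
  norm_o_le := fun α _ => by
    calc ‖sys.order α‖ = ‖∑ x, sys.o α x‖ := rfl
      _ ≤ ∑ x, ‖sys.o α x‖ := norm_sum_le _ _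
      _ ≤ ∑ _x : Λ, sys.obar := Finset.sum_le_sum fun x _ => sys.norm_o_le α x
      _ = sys.obar * Fintype.card Λ := by
          rw [Finset.sum_const, Finset.card_univ, nsmul_eq_mul]; ring
  obar_pos := mul_pos sys.obar_pos (Nat.cast_pos.mpr Fintype.card_pos)

variable [Nonempty Λ]

/-- The collapse has the same order operators. [cite: KomaTasaki1994, (2.13)] -/
@[simp] theorem collapse_order (α : Fin 2) : sys.collapse.order α = sys.order α := by
  simp [U1System.order, collapse]

/-- The collapse has the same Hamiltonian. [cite: KomaTasaki1994, (2.3)] -/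
@[simp] theorem collapse_hamiltonian : sys.collapse.hamiltonian = sys.hamiltonian := by
  simp [U1System.hamiltonian, collapse]

/-- The collapse has the same charge. [cite: KomaTasaki1994, (2.12)] -/
@[simp] theorem collapse_C : sys.collapse.C = sys.C := rfl

/-- The order-density bound of the collapse is `o N`. [cite: KomaTasaki1994, §2.3 iii)] -/
@[simp] theorem collapse_obar : sys.collapse.obar = sys.obar * Fintype.card Λ := rfl

/-- The raising operator `O^+ = O^{(1)} + iO^{(2)}` of a bounded-overlap system (inherited from the
collapse, KT (2.15)). [cite: KomaTasaki1994, (2.15)] -/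
abbrev orderPlus : E →L[ℂ] E := sys.collapse.orderPlus

/-- The lowering operator `O^- = O^{(1)} - iO^{(2)}` (inherited from the collapse, KT (2.15)).
[cite: KomaTasaki1994, (2.15)] -/
abbrev orderMinus : E →L[ℂ] E := sys.collapse.orderMinus

/-- The symmetry-breaking trial state `Ξ^{(k)} = (2k+1)^{-1/2}(Φ + Σ_{M=1}^k (Ψ^{(M)} + Ψ^{(-M)}))`
(KT (2.27); inherited from the collapse — it depends on the system only through `O^±`).
[cite: KomaTasaki1994, (2.27)] -/
abbrev xiState (k : ℕ) (Φ : E) : E := sys.collapse.xiState k Φ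

/-- `O^+ = O^{(1)} + iO^{(2)}` in terms of the total order operators of `sys`. [cite: KomaTasaki1994, (2.15)] -/
theorem orderPlus_eq : sys.orderPlus = sys.order 0 + I • sys.order 1 := by
  simp [orderPlus, U1System.orderPlus]

/-- `O^- = O^{(1)} - iO^{(2)}` in terms of the total order operators of `sys`. [cite: KomaTasaki1994, (2.15)] -/
theorem orderMinus_eq : sys.orderMinus = sys.order 0 - I • sys.order 1 := by
  simp [orderMinus, U1System.orderMinus]

/-! ### The state: long-range order without symmetry breaking (KT (2.17), iv)) -/

/-- **Hypothesis iv) for a bounded-overlap system** (KT §2.3 (2.17)): `Φ` is a normalised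
simultaneous eigenvector of `H_Λ` (eigenvalue `E`) and of `C_Λ` with
`⟨Φ, (O^{(1)})² Φ⟩ = ⟨Φ, (O^{(2)})² Φ⟩ ≥ (μ o N)²`, `0 < μ ≤ 1`.  By definition this is
`IsLROEigenstate` of the one-site collapse (same `H`, `C`, `O^{(α)}`, and `o′ · 1 = o N`).
[cite: KomaTasaki1994, §2.3 iv) (2.17)] -/
abbrev IsLROEigenstate (Φ : E) (EΛ μ : ℝ) : Prop :=
  KomaTasaki.IsLROEigenstate sys.collapse Φ EΛ μ

/-- Constructor of hypothesis iv) from data stated with the operators of `sys`.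
[cite: KomaTasaki1994, §2.3 iv) (2.17)] -/
theorem isLROEigenstate_of {Φ : E} {EΛ μ : ℝ} (hnorm : ‖Φ‖ = 1)
    (hH : sys.hamiltonian Φ = (EΛ : ℂ) • Φ) (hC : ∃ c : ℂ, sys.C Φ = c • Φ)
    (hμ : 0 < μ) (hμ1 : μ ≤ 1)
    (hlro : (μ * sys.obar * Fintype.card Λ) ^ 2 ≤ (⟪Φ, sys.order 0 (sys.order 0 Φ)⟫_ℂ).re)
    (hlro_eq : ⟪Φ, sys.order 0 (sys.order 0 Φ)⟫_ℂ = ⟪Φ, sys.order 1 (sys.order 1 Φ)⟫_ℂ) :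
    sys.IsLROEigenstate Φ EΛ μ where
  norm_eq_one := hnorm
  eigen_hamiltonian := by rw [collapse_hamiltonian]; exact hH
  eigen_C := hC
  mu_pos := hμ
  mu_le_one := hμ1
  lro := by
    rw [collapse_order, collapse_obar, Fintype.card_unit, Nat.cast_one, mul_one, ← mul_assoc]
    exact hlro
  lro_eq := by rw [collapse_order, collapse_order]; exact hlro_eq

/-- `‖Q‖ ≤ (2 o N)²` for `Q = (O^{(1)})² + (O^{(2)})²` of the collapse. [cite: KomaTasaki1994, §2.3 iii)] -/
theorem norm_orderSq_le : ‖sys.collapse.orderSq‖ ≤ (2 * sys.obar * Fintype.card Λ) ^ 2 := by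
  have h := sys.collapse.norm_orderSq_le
  simp only [collapse_obar, Fintype.card_unit, Nat.cast_one, mul_one] at h
  simpa [mul_assoc] using h

/-- (2.17) doubled: `2 (μ o N)² ≤ Re ⟪Φ, Q Φ⟫` for the collapse's `Q`. [cite: KomaTasaki1994, (2.17)] -/
theorem re_inner_orderSq_ge {Φ : E} {EΛ μ : ℝ} (hΦ : sys.IsLROEigenstate Φ EΛ μ) :
    2 * (μ * sys.obar * Fintype.card Λ) ^ 2 ≤ (⟪Φ, sys.collapse.orderSq Φ⟫_ℂ).re := by
  have h := sys.collapse.re_inner_orderSq_ge hΦ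
  simp only [collapse_obar, Fintype.card_unit, Nat.cast_one, mul_one, ← mul_assoc] at h
  exact h

/-! ### Locality re-injected: `‖[O^{(1)}, O^{(2)}]‖ ≤ 2 o² r′ N` -/

omit [Nonempty Λ] in
/-- **The commutator bound under bounded overlap**: `‖[O^{(1)}_Λ, O^{(2)}_Λ]‖ ≤ 2 o² r′ N`
(`[Σ_x o^{(1)}_x, Σ_y o^{(2)}_y] = Σ_x Σ_{y ∈ T_x} [o^{(1)}_x, o^{(2)}_y]` by i′), each term of norm
`≤ 2o²` by iii)).  This is the only place where hypothesis i)/i′) enters KT's argument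
(KT94 §4; KT93 (7.22) `‖[O^{(1)}, O^{(2)}]‖ ≤ 4o²N`). [cite: KomaTasaki1993, (7.22)]
[cite: KomaTasaki1994, §4] -/
theorem norm_orderComm_le :
    ‖sys.order 0 * sys.order 1 - sys.order 1 * sys.order 0‖ ≤
      2 * sys.obar ^ 2 * sys.r' * Fintype.card Λ := by
  classical
  have hexp : sys.order 0 * sys.order 1 - sys.order 1 * sys.order 0 =
      ∑ x, ∑ y ∈ sys.osupp x, (sys.o 0 x * sys.o 1 y - sys.o 1 y * sys.o 0 x) := by
    have h2 : sys.order 1 * sys.order 0 = ∑ x, ∑ y, sys.o 1 y * sys.o 0 x := by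
      rw [order, order, Finset.sum_mul_sum, Finset.sum_comm]
    have h1 : sys.order 0 * sys.order 1 - sys.order 1 * sys.order 0 =
        ∑ x, ∑ y, (sys.o 0 x * sys.o 1 y - sys.o 1 y * sys.o 0 x) := by
      rw [h2, order, order, Finset.sum_mul_sum, ← Finset.sum_sub_distrib]
      exact Finset.sum_congr rfl fun x _ => by rw [Finset.sum_sub_distrib]
    rw [h1]
    refine Finset.sum_congr rfl fun x _ => ?_
    symm
    refine Finset.sum_subset (Finset.subset_univ _) fun y _ hy => ?_
    exact sub_eq_zero.mpr (sys.commute_o x y hy 0 1).eq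
  rw [hexp]
  have ho : 0 ≤ sys.obar := sys.obar_pos.le
  calc ‖∑ x, ∑ y ∈ sys.osupp x, (sys.o 0 x * sys.o 1 y - sys.o 1 y * sys.o 0 x)‖
      ≤ ∑ x, ‖∑ y ∈ sys.osupp x, (sys.o 0 x * sys.o 1 y - sys.o 1 y * sys.o 0 x)‖ :=
        norm_sum_le _ _
    _ ≤ ∑ x, ∑ y ∈ sys.osupp x, ‖sys.o 0 x * sys.o 1 y - sys.o 1 y * sys.o 0 x‖ :=
        Finset.sum_le_sum fun x _ => norm_sum_le _ _
    _ ≤ ∑ x, ∑ _y ∈ sys.osupp x, 2 * sys.obar ^ 2 := by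
        refine Finset.sum_le_sum fun x _ => Finset.sum_le_sum fun y _ => ?_
        calc ‖sys.o 0 x * sys.o 1 y - sys.o 1 y * sys.o 0 x‖
            ≤ 2 * ‖sys.o 0 x‖ * ‖sys.o 1 y‖ := norm_comm_le _ _
          _ ≤ 2 * sys.obar * sys.obar := by
              have := sys.norm_o_le 0 x; have := sys.norm_o_le 1 y
              gcongr
          _ = 2 * sys.obar ^ 2 := by ring
    _ ≤ ∑ _x : Λ, (sys.r' : ℝ) * (2 * sys.obar ^ 2) := by
        refine Finset.sum_le_sum fun x _ => ?_
        rw [Finset.sum_const, nsmul_eq_mul]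
        have h1 : ((sys.osupp x).card : ℝ) ≤ sys.r' := by exact_mod_cast sys.card_osupp_le x
        exact mul_le_mul_of_nonneg_right h1 (by positivity)
    _ = 2 * sys.obar ^ 2 * sys.r' * Fintype.card Λ := by
        rw [Finset.sum_const, Finset.card_univ, nsmul_eq_mul]; ring

/-- The same bound for the collapse's commutator `K = [O^{(1)}, O^{(2)}]` (`U1System.orderComm`).
[cite: KomaTasaki1993, (7.22)] -/
theorem norm_orderComm_collapse_le :
    ‖sys.collapse.orderComm‖ ≤ 2 * sys.obar ^ 2 * sys.r' * Fintype.card Λ := by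
  rw [U1System.orderComm, collapse_order, collapse_order]
  exact sys.norm_orderComm_le

/-! ### KT93 Lemma 7.4–7.5 / (7.26) under bounded overlap:
`‖(O^±)^{k+1} Φ‖² ≥ (2μ²o²N²)^{k+1} - (k+1)² (o r′) (2oN)^{2k+1}` -/

/-- `[A, B²] = [A, B] B + B [A, B]`, as a norm bound. [folklore] -/
private theorem norm_comm_mul_self_le' (A B : E →L[ℂ] E) :
    ‖A * (B * B) - B * B * A‖ ≤ 2 * ‖A * B - B * A‖ * ‖B‖ := by
  have h : A * (B * B) - B * B * A = (A * B - B * A) * B + B * (A * B - B * A) := by noncomm_ring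
  rw [h]
  calc _ ≤ ‖(A * B - B * A) * B‖ + ‖B * (A * B - B * A)‖ := norm_add_le _ _
    _ ≤ ‖A * B - B * A‖ * ‖B‖ + ‖B‖ * ‖A * B - B * A‖ :=
        add_le_add (norm_mul_le _ _) (norm_mul_le _ _)
    _ = 2 * ‖A * B - B * A‖ * ‖B‖ := by ring

/-- `Re ⟪Φ, P Φ⟫ ≥ Re ⟪Φ, Q Φ⟫ - ‖P - Q‖` for a unit vector. [folklore] -/
private theorem re_inner_ge_sub_norm' (P Q : E →L[ℂ] E) {Φ : E} (hΦ : ‖Φ‖ = 1) :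
    (⟪Φ, Q Φ⟫_ℂ).re - ‖P - Q‖ ≤ (⟪Φ, P Φ⟫_ℂ).re := by
  have h : (⟪Φ, P Φ⟫_ℂ).re = (⟪Φ, Q Φ⟫_ℂ).re + (⟪Φ, (P - Q) Φ⟫_ℂ).re := by
    rw [sub_apply, inner_sub_right, Complex.sub_re]; ring
  have hb : |(⟪Φ, (P - Q) Φ⟫_ℂ).re| ≤ ‖P - Q‖ :=
    calc |(⟪Φ, (P - Q) Φ⟫_ℂ).re| ≤ ‖⟪Φ, (P - Q) Φ⟫_ℂ‖ := Complex.abs_re_le_norm _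
      _ ≤ ‖Φ‖ * ‖(P - Q) Φ‖ := norm_inner_le_norm _ _
      _ ≤ ‖Φ‖ * (‖P - Q‖ * ‖Φ‖) := by gcongr; exact (P - Q).le_opNorm Φ
      _ = ‖P - Q‖ := by rw [hΦ]; ring
  rw [h]
  linarith [(abs_le.mp hb).1]

/-- `‖[A, Q]‖ ≤ 2 (o r′) (2oN)²` for `Q = (O^{(1)})² + (O^{(2)})²` whenever
`‖[A, O^{(1)}]‖, ‖[A, O^{(2)}]‖ ≤ ‖[O^{(1)}, O^{(2)}]‖` (used for `A = O^±`), with the overlap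
commutator bound. [cite: KomaTasaki1993, Lemma 6.3 (6.10) / (7.21)–(7.22)] -/
theorem norm_comm_orderSq_le (A : E →L[ℂ] E)
    (hA0 : ‖A * sys.collapse.order 0 - sys.collapse.order 0 * A‖ ≤ ‖sys.collapse.orderComm‖)
    (hA1 : ‖A * sys.collapse.order 1 - sys.collapse.order 1 * A‖ ≤ ‖sys.collapse.orderComm‖) :
    ‖A * sys.collapse.orderSq - sys.collapse.orderSq * A‖ ≤
      2 * (sys.obar * sys.r') * (2 * sys.obar * Fintype.card Λ) ^ 2 := by
  have h0 : ‖sys.collapse.order 0‖ ≤ sys.obar * Fintype.card Λ := by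
    have h := sys.collapse.norm_order_le 0
    simp only [collapse_obar, Fintype.card_unit, Nat.cast_one, mul_one] at h
    exact h
  have h1 : ‖sys.collapse.order 1‖ ≤ sys.obar * Fintype.card Λ := by
    have h := sys.collapse.norm_order_le 1
    simp only [collapse_obar, Fintype.card_unit, Nat.cast_one, mul_one] at h
    exact h
  have hK := sys.norm_orderComm_collapse_le
  have hoN : 0 ≤ sys.obar * Fintype.card Λ := mul_nonneg sys.obar_pos.le (Nat.cast_nonneg _)
  have hsplit : A * sys.collapse.orderSq - sys.collapse.orderSq * A =
      (A * (sys.collapse.order 0 * sys.collapse.order 0)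
          - sys.collapse.order 0 * sys.collapse.order 0 * A)
        + (A * (sys.collapse.order 1 * sys.collapse.order 1)
          - sys.collapse.order 1 * sys.collapse.order 1 * A) := by
    simp only [U1System.orderSq, mul_add, add_mul]
    abel
  rw [hsplit]
  calc _ ≤ ‖A * (sys.collapse.order 0 * sys.collapse.order 0)
            - sys.collapse.order 0 * sys.collapse.order 0 * A‖
        + ‖A * (sys.collapse.order 1 * sys.collapse.order 1)
            - sys.collapse.order 1 * sys.collapse.order 1 * A‖ := norm_add_le _ _
    _ ≤ 2 * ‖A * sys.collapse.order 0 - sys.collapse.order 0 * A‖ * ‖sys.collapse.order 0‖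
        + 2 * ‖A * sys.collapse.order 1 - sys.collapse.order 1 * A‖ * ‖sys.collapse.order 1‖ :=
          add_le_add (norm_comm_mul_self_le' _ _) (norm_comm_mul_self_le' _ _)
    _ ≤ 2 * ‖sys.collapse.orderComm‖ * (sys.obar * Fintype.card Λ)
        + 2 * ‖sys.collapse.orderComm‖ * (sys.obar * Fintype.card Λ) := by
          gcongr
    _ ≤ 2 * (2 * sys.obar ^ 2 * sys.r' * Fintype.card Λ) * (sys.obar * Fintype.card Λ)
        + 2 * (2 * sys.obar ^ 2 * sys.r' * Fintype.card Λ) * (sys.obar * Fintype.card Λ) := by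
          gcongr
    _ = 2 * (sys.obar * sys.r') * (2 * sys.obar * Fintype.card Λ) ^ 2 := by ring

/-- **Lower bound on `‖(O^+)^{k+1} Φ‖²` under bounded overlap** (KT93 (7.15), (7.18)):
`‖(O^+)^{k+1} Φ‖² ≥ ⟨Φ, Q^{k+1} Φ⟩ - (k+1)² (o r′) (2oN)^{2k+1} ≥ (2μ²o²N²)^{k+1} - (k+1)² (o r′) (2oN)^{2k+1}`.
[cite: KomaTasaki1993, Lemma 7.4 (7.15), Lemma 7.5 (7.18), (7.26)] -/
theorem norm_sq_orderPlus_pow_ge [FiniteDimensional ℂ E] {Φ : E} {EΛ μ : ℝ}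
    (hΦ : sys.IsLROEigenstate Φ EΛ μ) (k : ℕ) :
    (2 * (μ * sys.obar * Fintype.card Λ) ^ 2) ^ (k + 1)
        - ((k : ℝ) + 1) ^ 2 * (sys.obar * sys.r') * (2 * sys.obar * Fintype.card Λ) ^ (2 * k + 1)
      ≤ ‖(sys.orderPlus ^ (k + 1)) Φ‖ ^ 2 := by
  set S := sys.collapse with hS
  have hα : 0 ≤ 2 * sys.obar * Fintype.card Λ := by
    have := sys.obar_pos.le; positivity
  have hδ : 0 ≤ sys.obar * sys.r' := mul_nonneg sys.obar_pos.le (Nat.cast_nonneg _)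
  have hOm : ‖S.orderMinus‖ ≤ 2 * sys.obar * Fintype.card Λ := by
    have h := S.norm_orderMinus_le
    simp only [hS, collapse_obar, Fintype.card_unit, Nat.cast_one, mul_one] at h
    simpa [hS, mul_assoc] using h
  have hOp : ‖S.orderPlus‖ ≤ 2 * sys.obar * Fintype.card Λ := by
    have h := S.norm_orderPlus_le
    simp only [hS, collapse_obar, Fintype.card_unit, Nat.cast_one, mul_one] at h
    simpa [hS, mul_assoc] using h
  have hQ : ‖S.orderSq‖ ≤ (2 * sys.obar * Fintype.card Λ) ^ 2 := sys.norm_orderSq_le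
  have h1 : ‖(S.orderPlus ^ (k + 1)) Φ‖ ^ 2 =
      (⟪Φ, (S.orderMinus ^ (k + 1) * S.orderPlus ^ (k + 1)) Φ⟫_ℂ).re := by
    rw [mul_apply_eq_comp, ← S.inner_orderPlus_pow_left, inner_self_eq_norm_sq_to_K]
    norm_cast
  have hAB : ‖S.orderMinus * S.orderPlus - S.orderSq‖
      ≤ (sys.obar * sys.r') * (2 * sys.obar * Fintype.card Λ) := by
    rw [S.orderMinus_mul_orderPlus, add_sub_cancel_left, norm_smul, Complex.norm_I, one_mul]
    calc ‖S.orderComm‖ ≤ 2 * sys.obar ^ 2 * sys.r' * Fintype.card Λ :=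
          sys.norm_orderComm_collapse_le
      _ = (sys.obar * sys.r') * (2 * sys.obar * Fintype.card Λ) := by ring
  have hAQ : ‖S.orderMinus * S.orderSq - S.orderSq * S.orderMinus‖
      ≤ 2 * (sys.obar * sys.r') * (2 * sys.obar * Fintype.card Λ) ^ 2 := by
    refine sys.norm_comm_orderSq_le _ ?_ ?_
    · rw [S.orderMinus_comm_order_zero, norm_smul, Complex.norm_I, one_mul]
    · rw [S.orderMinus_comm_order_one]
  have h2 := norm_pow_mul_pow_sub_pow_le S.orderMinus S.orderPlus S.orderSq hα hδ hOm hOp hQ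
    hAB hAQ k
  have hlro : 2 * (μ * sys.obar * Fintype.card Λ) ^ 2 ≤ (⟪Φ, S.orderSq Φ⟫_ℂ).re :=
    sys.re_inner_orderSq_ge hΦ
  have h3 : (2 * (μ * sys.obar * Fintype.card Λ) ^ 2) ^ (k + 1)
      ≤ (⟪Φ, (S.orderSq ^ (k + 1)) Φ⟫_ℂ).re :=
    (pow_le_pow_left₀ (by positivity) hlro _).trans
      (pow_re_inner_le_re_inner_pow S.orderSq S.isSymmetric_orderSq
        (fun x => by rw [S.re_inner_orderSq]; positivity) hΦ.norm_eq_one (k + 1))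
  have h4 := re_inner_ge_sub_norm' (S.orderMinus ^ (k + 1) * S.orderPlus ^ (k + 1))
    (S.orderSq ^ (k + 1)) hΦ.norm_eq_one
  change _ ≤ ‖(S.orderPlus ^ (k + 1)) Φ‖ ^ 2
  rw [h1]
  linarith

/-- **Lower bound on `‖(O^-)^{k+1} Φ‖²` under bounded overlap** (mirror image, KT93 after (7.19)).
[cite: KomaTasaki1993, Lemma 7.4 (7.15), Lemma 7.5 (7.18)–(7.19), (7.26)] -/
theorem norm_sq_orderMinus_pow_ge [FiniteDimensional ℂ E] {Φ : E} {EΛ μ : ℝ}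
    (hΦ : sys.IsLROEigenstate Φ EΛ μ) (k : ℕ) :
    (2 * (μ * sys.obar * Fintype.card Λ) ^ 2) ^ (k + 1)
        - ((k : ℝ) + 1) ^ 2 * (sys.obar * sys.r') * (2 * sys.obar * Fintype.card Λ) ^ (2 * k + 1)
      ≤ ‖(sys.orderMinus ^ (k + 1)) Φ‖ ^ 2 := by
  set S := sys.collapse with hS
  have hα : 0 ≤ 2 * sys.obar * Fintype.card Λ := by
    have := sys.obar_pos.le; positivity
  have hδ : 0 ≤ sys.obar * sys.r' := mul_nonneg sys.obar_pos.le (Nat.cast_nonneg _)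
  have hOm : ‖S.orderMinus‖ ≤ 2 * sys.obar * Fintype.card Λ := by
    have h := S.norm_orderMinus_le
    simp only [hS, collapse_obar, Fintype.card_unit, Nat.cast_one, mul_one] at h
    simpa [hS, mul_assoc] using h
  have hOp : ‖S.orderPlus‖ ≤ 2 * sys.obar * Fintype.card Λ := by
    have h := S.norm_orderPlus_le
    simp only [hS, collapse_obar, Fintype.card_unit, Nat.cast_one, mul_one] at h
    simpa [hS, mul_assoc] using h
  have hQ : ‖S.orderSq‖ ≤ (2 * sys.obar * Fintype.card Λ) ^ 2 := sys.norm_orderSq_le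
  have h1 : ‖(S.orderMinus ^ (k + 1)) Φ‖ ^ 2 =
      (⟪Φ, (S.orderPlus ^ (k + 1) * S.orderMinus ^ (k + 1)) Φ⟫_ℂ).re := by
    rw [mul_apply_eq_comp, ← S.inner_orderMinus_pow_left, inner_self_eq_norm_sq_to_K]
    norm_cast
  have hAB : ‖S.orderPlus * S.orderMinus - S.orderSq‖
      ≤ (sys.obar * sys.r') * (2 * sys.obar * Fintype.card Λ) := by
    rw [S.orderPlus_mul_orderMinus, sub_sub_cancel_left, norm_neg, norm_smul, Complex.norm_I,
      one_mul]
    calc ‖S.orderComm‖ ≤ 2 * sys.obar ^ 2 * sys.r' * Fintype.card Λ :=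
          sys.norm_orderComm_collapse_le
      _ = (sys.obar * sys.r') * (2 * sys.obar * Fintype.card Λ) := by ring
  have hAQ : ‖S.orderPlus * S.orderSq - S.orderSq * S.orderPlus‖
      ≤ 2 * (sys.obar * sys.r') * (2 * sys.obar * Fintype.card Λ) ^ 2 := by
    refine sys.norm_comm_orderSq_le _ ?_ ?_
    · rw [S.orderPlus_comm_order_zero, norm_neg, norm_smul, Complex.norm_I, one_mul]
    · rw [S.orderPlus_comm_order_one]
  have h2 := norm_pow_mul_pow_sub_pow_le S.orderPlus S.orderMinus S.orderSq hα hδ hOp hOm hQ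
    hAB hAQ k
  have hlro : 2 * (μ * sys.obar * Fintype.card Λ) ^ 2 ≤ (⟪Φ, S.orderSq Φ⟫_ℂ).re :=
    sys.re_inner_orderSq_ge hΦ
  have h3 : (2 * (μ * sys.obar * Fintype.card Λ) ^ 2) ^ (k + 1)
      ≤ (⟪Φ, (S.orderSq ^ (k + 1)) Φ⟫_ℂ).re :=
    (pow_le_pow_left₀ (by positivity) hlro _).trans
      (pow_re_inner_le_re_inner_pow S.orderSq S.isSymmetric_orderSq
        (fun x => by rw [S.re_inner_orderSq]; positivity) hΦ.norm_eq_one (k + 1))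
  have h4 := re_inner_ge_sub_norm' (S.orderPlus ^ (k + 1) * S.orderMinus ^ (k + 1))
    (S.orderSq ^ (k + 1)) hΦ.norm_eq_one
  change _ ≤ ‖(S.orderMinus ^ (k + 1)) Φ‖ ^ 2
  rw [h1]
  linarith

/-! ### KT94 Theorem 2.5 (2.30) under bounded overlap: the finite-volume bound -/

/-- **KT94 Theorem 2.5 (2.30), finite-volume quantitative form, BOUNDED-OVERLAP densities — PROVED.**
For a bounded-overlap `U(1)` system (i′) with overlap bound `r′`, iii)) and a state `Φ` with obscured
symmetry breaking iv) (2.17), for every `k ≥ 1` and every `N = |Λ|`, the symmetry-breaking trial state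
`Ξ^{(k)}` (2.27) has `Re (Ξ^{(k)}, O^{(1)} Ξ^{(k)}) ≥ 0` and

  `(2 (μ o N)²)^k - k² (o r′) (2 o N)^{2k-1} ≤ ( (2k+1)/(2k) · Re (Ξ^{(k)}, O^{(1)} Ξ^{(k)}) )^{2k}`,

i.e. `N⁻¹ (Ξ^{(k)}, O^{(1)} Ξ^{(k)}) ≥ (2k/(2k+1)) ((2μ²o²)^k - k² r′ 2^{2k-1} o^{2k} N⁻¹)₊^{1/(2k)}`
(KT's bound is the case `r′ = 1`).  Assembly = the tree's `U1System.theorem_2_5_orderOne_fin_of_le`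
applied to the one-site collapse with the moment bounds of this file.
[cite: KomaTasaki1994, Theorem 2.5 (2.30)] [cite: KomaTasaki1993, Theorem 7.3, (7.25)–(7.26)] -/
theorem theorem_2_5_orderOne_fin [FiniteDimensional ℂ E] {Φ : E} {EΛ μ : ℝ}
    (hΦ : sys.IsLROEigenstate Φ EΛ μ) (k : ℕ) (hk : 1 ≤ k) :
    0 ≤ (⟪sys.xiState k Φ, sys.order 0 (sys.xiState k Φ)⟫_ℂ).re ∧
      (2 * (μ * sys.obar * Fintype.card Λ) ^ 2) ^ k
          - (k : ℝ) ^ 2 * (sys.obar * sys.r') * (2 * sys.obar * Fintype.card Λ) ^ (2 * k - 1)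
        ≤ ((2 * k + 1) / (2 * k) * (⟪sys.xiState k Φ, sys.order 0 (sys.xiState k Φ)⟫_ℂ).re)
          ^ (2 * k) := by
  obtain ⟨k, rfl⟩ : ∃ k', k = k' + 1 := ⟨k - 1, by omega⟩
  have e1 : 2 * (k + 1) - 1 = 2 * k + 1 := by omega
  have hL' : ((k + 1 : ℕ) : ℝ) ^ 2 = ((k : ℝ) + 1) ^ 2 := by push_cast; ring
  have ha2 := sys.norm_sq_orderPlus_pow_ge hΦ k
  have hb2 := sys.norm_sq_orderMinus_pow_ge hΦ k
  rw [← hL'] at ha2 hb2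
  have h := sys.collapse.theorem_2_5_orderOne_fin_of_le hΦ (k + 1) hk ha2 hb2
  rw [collapse_order] at h
  rw [e1]
  exact h

/-! ### KT94 Theorem 2.5 (2.30) under bounded overlap: the double limit -/

end U1OverlapSystem

/-- **KT94 Theorem 2.5, (2.30), `U(1)` case, bounded-overlap densities**:
`lim_{k→∞} lim_{Λ} N⁻¹ (Ξ^{(k)}, O^{(1)} Ξ^{(k)}) ≥ √2 μ o`, in `ε`–`k₀`–`N₀` form, UNIFORMLY over all
bounded-overlap `U(1)` systems with order-operator bound `o = ob`, overlap bound `r′ ≤ R` and states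
with LRO parameter `μ`: for every `ε > 0` there is `k₀` such that for every `k ≥ k₀` there is `N₀` with
`N⁻¹ Re (Ξ^{(k)}, O^{(1)} Ξ^{(k)}) ≥ √2 μ o - ε` whenever `N ≥ N₀`. [cite: KomaTasaki1994, Theorem 2.5 (2.30)]
[cite: KomaTasaki1993, Theorem 7.3] -/
def theorem_2_5_orderOne_overlap : Prop :=
  ∀ (μ ob ε : ℝ) (R : ℕ), 0 < ε → ∃ k₀ : ℕ, ∀ k : ℕ, k₀ ≤ k → ∃ N₀ : ℕ,
    ∀ {Λ : Type u} [Fintype Λ] [Nonempty Λ] {E : Type v} [NormedAddCommGroup E]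
      [InnerProductSpace ℂ E] [FiniteDimensional ℂ E] (sys : U1OverlapSystem Λ E) (Φ : E) (EΛ : ℝ),
      sys.IsLROEigenstate Φ EΛ μ → sys.obar = ob → sys.r' ≤ R → N₀ ≤ Fintype.card Λ →
      Real.sqrt 2 * μ * ob - ε ≤
        (⟪sys.xiState k Φ, sys.order 0 (sys.xiState k Φ)⟫_ℂ).re / Fintype.card Λ

/-- **KT94 Theorem 2.5 (2.30), bounded-overlap densities — PROVED** (from
`U1OverlapSystem.theorem_2_5_orderOne_fin`: choose `k₀ > √2μo/ε`, then
`N₀ > k² R 2^{2k-1} o^{2k} / ((√2μo)^{2k} - (√2μo - ε/2)^{2k})`).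
[cite: KomaTasaki1994, Theorem 2.5 (2.30)] [cite: KomaTasaki1993, Theorem 7.3 (7.26)] -/
theorem theorem_2_5_orderOne_overlap_holds : theorem_2_5_orderOne_overlap.{u, v} := by
  intro μ ob ε R hε
  set s : ℝ := Real.sqrt 2 * μ * ob with hs_def
  have hs2 : s ^ 2 = 2 * μ ^ 2 * ob ^ 2 := by
    rw [hs_def, mul_pow, mul_pow, Real.sq_sqrt (by norm_num : (0 : ℝ) ≤ 2)]
  by_cases hεs : s ≤ ε / 2
  · -- trivial case: the target `s - ε` is negative
    refine ⟨1, fun k hk => ⟨0, ?_⟩⟩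
    intro Λ _ _ E _ _ _ sys Φ EΛ hΦ _hob _hR _hN
    have hx := (sys.theorem_2_5_orderOne_fin hΦ k hk).1
    have : 0 ≤ (⟪sys.xiState k Φ, sys.order 0 (sys.xiState k Φ)⟫_ℂ).re / Fintype.card Λ :=
      div_nonneg hx (Nat.cast_nonneg _)
    linarith
  push Not at hεs
  have hs : 0 < s := by linarith
  -- `k₀ > s / ε`
  refine ⟨⌈s / ε⌉₊ + 1, fun k hk => ?_⟩
  have hk1 : 1 ≤ k := by omega
  have hkε : s ≤ k * ε := by
    have h1 : s / ε ≤ ⌈s / ε⌉₊ := Nat.le_ceil _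
    have h2 : ((⌈s / ε⌉₊ + 1 : ℕ) : ℝ) ≤ k := by exact_mod_cast hk
    push_cast at h2
    have h3 : s / ε ≤ k := by linarith
    rwa [div_le_iff₀ hε] at h3
  obtain ⟨k, rfl⟩ : ∃ k', k = k' + 1 := ⟨k - 1, by omega⟩
  -- the gap `G = s^{2k} - (s - ε/2)^{2k} > 0` and the constant `c = k² R 2^{2k-1} ob^{2k}`
  set G : ℝ := (2 * μ ^ 2 * ob ^ 2) ^ (k + 1) - (s - ε / 2) ^ (2 * k + 2) with hG_def
  have hG : 0 < G := by
    have h1 : (s - ε / 2) ^ (2 * k + 2) < s ^ (2 * k + 2) :=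
      pow_lt_pow_left₀ (by linarith) (by linarith) (by omega)
    have h2 : s ^ (2 * k + 2) = (2 * μ ^ 2 * ob ^ 2) ^ (k + 1) := by
      rw [← hs2, ← pow_mul]; ring_nf
    rw [hG_def]; linarith
  set cst : ℝ := ((k : ℝ) + 1) ^ 2 * R * 2 ^ (2 * k + 1) * ob ^ (2 * k + 2) with hcst_def
  refine ⟨⌈cst / G⌉₊ + 1, ?_⟩
  intro Λ _ _ E _ _ _ sys Φ EΛ hΦ hob hR hN
  have hNpos : (0 : ℝ) < Fintype.card Λ := by
    have : 1 ≤ Fintype.card Λ := le_trans (by omega) hN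
    exact_mod_cast Nat.lt_of_lt_of_le Nat.zero_lt_one this
  have hNG : cst ≤ Fintype.card Λ * G := by
    have h1 : cst / G ≤ ⌈cst / G⌉₊ := Nat.le_ceil _
    have h2 : ((⌈cst / G⌉₊ + 1 : ℕ) : ℝ) ≤ Fintype.card Λ := by exact_mod_cast hN
    push_cast at h2
    have h3 : cst / G ≤ Fintype.card Λ := by linarith
    rwa [div_le_iff₀ hG] at h3
  obtain ⟨hx0, hfin⟩ := sys.theorem_2_5_orderOne_fin hΦ (k + 1) hk1
  rw [hob] at hfin
  -- the overlap bound `r' ≤ R` and `ob > 0`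
  have hob0 : 0 < ob := hob ▸ sys.obar_pos
  have hR' : (sys.r' : ℝ) ≤ R := by exact_mod_cast hR
  -- abbreviations
  set N : ℝ := (Fintype.card Λ : ℝ) with hN_def
  set x : ℝ := (⟪sys.xiState (k + 1) Φ, sys.order 0 (sys.xiState (k + 1) Φ)⟫_ℂ).re with hx_def
  by_contra hcon
  push Not at hcon
  -- `x < (s - ε) N`, hence `r x < (s - ε/2) N` with `r = (2k+3)/(2k+2)`
  have hxlt : x < (s - ε) * N := by rwa [div_lt_iff₀ hNpos] at hcon
  have hsε : 0 < s - ε := by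
    by_contra h
    push Not at h
    have : x < 0 := lt_of_lt_of_le hxlt (mul_nonpos_of_nonpos_of_nonneg h hNpos.le)
    linarith
  have hr0 : (0 : ℝ) < (2 * ((k + 1 : ℕ) : ℝ) + 1) / (2 * ((k + 1 : ℕ) : ℝ)) := by positivity
  have hr : (2 * ((k + 1 : ℕ) : ℝ) + 1) / (2 * ((k + 1 : ℕ) : ℝ)) * ((s - ε) * N)
      ≤ (s - ε / 2) * N := by
    rw [div_mul_eq_mul_div, div_le_iff₀ (by positivity)]
    push_cast
    have hkε' : s ≤ ((k : ℝ) + 1) * ε := by push_cast at hkε; exact hkε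
    nlinarith
  have hrx : (2 * ((k + 1 : ℕ) : ℝ) + 1) / (2 * ((k + 1 : ℕ) : ℝ)) * x < (s - ε / 2) * N :=
    lt_of_lt_of_le (mul_lt_mul_of_pos_left hxlt hr0) hr
  have hpow : ((2 * ((k + 1 : ℕ) : ℝ) + 1) / (2 * ((k + 1 : ℕ) : ℝ)) * x) ^ (2 * (k + 1))
      < ((s - ε / 2) * N) ^ (2 * (k + 1)) :=
    pow_lt_pow_left₀ hrx (mul_nonneg hr0.le hx0) (by omega)
  -- `L ≥ ((s - ε/2) N)^{2k+2}`
  have e1 : 2 * (k + 1) - 1 = 2 * k + 1 := by omega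
  rw [e1] at hfin
  -- replace `r'` by `R` in the error term
  have herr : ((k + 1 : ℕ) : ℝ) ^ 2 * (ob * sys.r') * (2 * ob * N) ^ (2 * k + 1)
      ≤ ((k + 1 : ℕ) : ℝ) ^ 2 * (ob * R) * (2 * ob * N) ^ (2 * k + 1) := by
    have h1 : ob * sys.r' ≤ ob * R := mul_le_mul_of_nonneg_left hR' hob0.le
    have h2 : 0 ≤ (2 * ob * N) ^ (2 * k + 1) := pow_nonneg (by positivity) _
    have h3 : 0 ≤ ((k + 1 : ℕ) : ℝ) ^ 2 := by positivity
    exact mul_le_mul_of_nonneg_right (mul_le_mul_of_nonneg_left h1 h3) h2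
  have hfin' : (2 * (μ * ob * N) ^ 2) ^ (k + 1)
      - ((k + 1 : ℕ) : ℝ) ^ 2 * (ob * R) * (2 * ob * N) ^ (2 * k + 1)
      ≤ ((2 * ((k + 1 : ℕ) : ℝ) + 1) / (2 * ((k + 1 : ℕ) : ℝ)) * x) ^ (2 * (k + 1)) := by
    linarith
  have hkey : (2 * (μ * ob * N) ^ 2) ^ (k + 1)
      - ((k + 1 : ℕ) : ℝ) ^ 2 * (ob * R) * (2 * ob * N) ^ (2 * k + 1)
      - ((s - ε / 2) * N) ^ (2 * (k + 1)) = N ^ (2 * k + 1) * (N * G - cst) := by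
    rw [hG_def, hcst_def, mul_pow (s - ε / 2) N]
    push_cast
    ring
  have hLge : ((s - ε / 2) * N) ^ (2 * (k + 1)) ≤ (2 * (μ * ob * N) ^ 2) ^ (k + 1)
      - ((k + 1 : ℕ) : ℝ) ^ 2 * (ob * R) * (2 * ob * N) ^ (2 * k + 1) := by
    have : 0 ≤ N ^ (2 * k + 1) * (N * G - cst) :=
      mul_nonneg (pow_nonneg hNpos.le _) (by linarith)
    linarith
  -- contradiction
  have := lt_of_le_of_lt (hLge.trans hfin') hpow
  exact lt_irrefl _ this

/-- **KT94 Theorem 2.5 (2.30) along a sequence of lattices** (bounded-overlap densities): for systems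
on lattices `Λ_j` with `N_j → ∞`, common order-operator bound `o`, common overlap bound `R ≥ r′_j` and
LRO parameter `μ`, `∀ ε > 0, ∃ k₀, ∀ k ≥ k₀, ∀ᶠ j, N_j⁻¹ Re (Ξ^{(k)}_j, O^{(1)}_j Ξ^{(k)}_j) ≥ √2 μ o - ε`.
[cite: KomaTasaki1994, Theorem 2.5 (2.30)] [cite: KomaTasaki1993, Theorem 7.3] -/
theorem theorem_2_5_orderOne_overlap_seq (Λ : ℕ → Type u) [∀ j, Fintype (Λ j)]
    [∀ j, Nonempty (Λ j)] (E : ℕ → Type v)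
    [∀ j, NormedAddCommGroup (E j)] [∀ j, InnerProductSpace ℂ (E j)]
    [∀ j, FiniteDimensional ℂ (E j)] (sys : ∀ j, U1OverlapSystem (Λ j) (E j)) (Φ : ∀ j, E j)
    (EΛ : ℕ → ℝ) (μ ob : ℝ) (R : ℕ) (hΦ : ∀ j, (sys j).IsLROEigenstate (Φ j) (EΛ j) μ)
    (hob : ∀ j, (sys j).obar = ob) (hR : ∀ j, (sys j).r' ≤ R)
    (hN : Tendsto (fun j => Fintype.card (Λ j)) atTop atTop) :
    ∀ ε : ℝ, 0 < ε → ∃ k₀ : ℕ, ∀ k : ℕ, k₀ ≤ k → ∀ᶠ j in atTop,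
      Real.sqrt 2 * μ * ob - ε ≤
        (⟪(sys j).xiState k (Φ j), (sys j).order 0 ((sys j).xiState k (Φ j))⟫_ℂ).re
          / Fintype.card (Λ j) := by
  intro ε hε
  obtain ⟨k₀, hk₀⟩ := theorem_2_5_orderOne_overlap_holds.{u, v} μ ob ε R hε
  refine ⟨k₀, fun k hk => ?_⟩
  obtain ⟨N₀, hN₀⟩ := hk₀ k hk
  filter_upwards [Filter.tendsto_atTop.mp hN N₀] with j hj
  exact hN₀ (sys j) (Φ j) (EΛ j) (hΦ j) (hob j) (hR j) hj

end Literature.MathematicalPhysics.QuantumLattice.KomaTasaki
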